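import Summits.CriticalPhenomena.PercolationContinuityZ3.Theorems.PercNearOneGluingNoHeavyLowerTailSahiCombTriWAntiNestedKernelProof
import Summits.CriticalPhenomena.PercolationContinuityZ3.Theorems.PercNearOneGluingNoHeavyLowerTailSahiCombTriWBotEmptyHalfChain

/-!
# The UNCROSSING IDENTITY for `TRI_W(2)` and the CROSSING-FREE stratum (unconditional)

Support file of the one-cut programme (crux `NoHeavyLowerTail`, stmt-CriticalPhenomena-4575; TRI lane of cell `prim-masterthm`; seat prim-lf-1 gen 38,
memo `FROM-prim-lf-1-gen38-AN3-KERNEL.md` §6).  Target `FiveUpSet.TriWIneq` at `a = 2` (index cube `univ = {a,b}`, pair form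
`triW = triWOne(P; F ∅, F univ; G ∅, G univ) + triWOne(P; F{a}, F{b}; G{a}, G{b})`, `…TriWBotEmptyHalfChain.triW_eq_pairSum`).

The thin-edge functional `triWOne(P; A, A'; B, B')` is BILINEAR in the indicator vectors of the pair `(A, A')` and of the pair `(B, B')`
(every one of its ten terms is a count `#(P ∩ X ∩ Y)` with `X ∈ {A, A', refl A, refl A'}`, `Y ∈ {B, B', refl B, refl B'}`).  Splitting
`1_A = 1_{A∩A'} + 1_{A∖A'}`, `1_{A'} = 1_{A∩A'} + 1_{A'∖A}` (and for `B`) and expanding gives the EXACT identity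

  `triWOne(P; A, A'; B, B') = triWOne(P; A∩A', A∪A'; B∪B', B∩B') + X(A∖A', B∖B') + X(A'∖A, B'∖B)`,
  `X(U, V) := 2·#(P∩U∩V) + #(P ∩ refl U ∩ V) + #(P ∩ U ∩ refl V) − 2·#(P ∩ refl U ∩ refl V)`          (`triWOne_uncross_eq`)

(the uncrossed middle pair `(A∩A', A∪A')`, `(B∪B', B∩B')` is ANTI-NESTED).  Hence for every `a = 2` configuration
`triW P F G = triW P F⁻ G⁺ + X(F{a}∖F{b}, G{a}∖G{b}) + X(F{b}∖F{a}, G{b}∖G{a})` with the anti-nested uncrossed families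
`F⁻ = (F ∅, F{a}∩F{b}, F{a}∪F{b}, F univ)`, `G⁺ = (G ∅, G{a}∪G{b}, G{a}∩G{b}, G univ)` (`triW_uncross_eq`), and by the anti-nested stratum theorem
(`triW_nonneg_of_antiNested_stratum`, AN♯3):

* **`FiveUpSet.triW_ge_cross`** — `triW P F G ≥ X(F{a}∖F{b}, G{a}∖G{b}) + X(F{b}∖F{a}, G{b}∖G{a})` for all monotone families of up-sets and every
  up-set `P`: the whole deficit of `TRI_W(2)` sits on the two DOUBLE-CROSSING cells `D_a = (F{a}∖F{b}) ∩ (G{a}∖G{b})`, `D_b` (the cells of shell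
  weight 2) through the terms `−2·#(P ∩ refl D)`;
* **`FiveUpSet.triW_nonneg_of_refl_crossings_disjoint`** — if no point of `P` is the complement of a double-crossing point
  (`P ∩ refl D_a = ∅ = P ∩ refl D_b`), then `0 ≤ triW P F G`;
* **`FiveUpSet.triW_nonneg_of_crossing_free`** — THE CROSSING-FREE STRATUM: if `F{a} ∩ G{a} ⊆ F{b} ∪ G{b}` and `F{b} ∩ G{b} ⊆ F{a} ∪ G{a}`
  (no double crossings; contains BOTH anti-nested strata, symmetric in `a ↔ b` and `F ↔ G`), then `0 ≤ triW P F G` — unconditional, new.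
So the open part of `TriWIneq` at `a = 2` (`ChainTwoIneq`) is exactly the absorption of `2·#(P ∩ refl D)` for the double-crossing cells.
HONEST LABEL: an exact identity (bilinear bookkeeping) and its corollaries via AN♯3; std axioms. [this work]
-/

namespace Summit.CriticalPhenomena.PercolationContinuityZ3.Theorems

namespace FiveUpSet

open Finset LatticeFiveUpSet

variable {γ : Type} [DecidableEq γ] [Fintype γ]

/-! ### Counting through indicator sums -/

omit [Fintype γ] in
/-- `#(P ∩ X ∩ Y)` as a sum of products of indicators over `P`. [folklore] -/
theorem card_inter_inter_eq_sum_ite (P X Y : Finset (Finset γ)) :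
    ((P ∩ X ∩ Y).card : ℤ) = ∑ e ∈ P, (if e ∈ X then (1 : ℤ) else 0) * (if e ∈ Y then (1 : ℤ) else 0) := by
  have h1 : P ∩ X ∩ Y = P.filter (fun e => e ∈ X ∧ e ∈ Y) := by
    ext e; simp only [mem_inter, mem_filter, and_assoc]
  rw [h1, Finset.card_filter]
  push_cast
  refine Finset.sum_congr rfl fun e _ => ?_
  by_cases hx : e ∈ X <;> by_cases hy : e ∈ Y <;> simp [hx, hy]

omit [Fintype γ] in
/-- Indicator of an intersection. [folklore] -/
theorem ite_mem_inter_eq (X Y : Finset (Finset γ)) (e : Finset γ) :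
    (if e ∈ X ∩ Y then (1 : ℤ) else 0) = (if e ∈ X then (1 : ℤ) else 0) * (if e ∈ Y then (1 : ℤ) else 0) := by
  by_cases hx : e ∈ X <;> by_cases hy : e ∈ Y <;> simp [hx, hy]

omit [Fintype γ] in
/-- Indicator of a union. [folklore] -/
theorem ite_mem_union_eq (X Y : Finset (Finset γ)) (e : Finset γ) :
    (if e ∈ X ∪ Y then (1 : ℤ) else 0)
      = (if e ∈ X then (1 : ℤ) else 0) + (if e ∈ Y then (1 : ℤ) else 0) - (if e ∈ X then (1 : ℤ) else 0) * (if e ∈ Y then (1 : ℤ) else 0) := by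
  by_cases hx : e ∈ X <;> by_cases hy : e ∈ Y <;> simp [hx, hy]

omit [Fintype γ] in
/-- Indicator of a difference. [folklore] -/
theorem ite_mem_sdiff_eq (X Y : Finset (Finset γ)) (e : Finset γ) :
    (if e ∈ X \ Y then (1 : ℤ) else 0) = (if e ∈ X then (1 : ℤ) else 0) * (1 - (if e ∈ Y then (1 : ℤ) else 0)) := by
  by_cases hx : e ∈ X <;> by_cases hy : e ∈ Y <;> simp [hx, hy]

/-! ### The uncrossing identity -/

/-- **THE UNCROSSING IDENTITY** (exact, for arbitrary finsets `P, A, A', B, B'`):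
`triWOne(P;A,A';B,B') = triWOne(P; A∩A', A∪A'; B∪B', B∩B') + X(A∖A', B∖B') + X(A'∖A, B'∖B)`,
`X(U,V) = 2·#(P∩U∩V) + #(P∩refl U∩V) + #(P∩U∩refl V) − 2·#(P∩refl U∩refl V)`.  Proof: bilinearity of `triWOne` in the indicator vectors
(every count is an indicator sum over `P`; the summands agree by `ring`). [this work] -/
theorem triWOne_uncross_eq (P A A' B B' : Finset (Finset γ)) :
    triWOne (complEquiv γ) P A A' B B'
      = triWOne (complEquiv γ) P (A ∩ A') (A ∪ A') (B ∪ B') (B ∩ B')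
        + (2 * ((P ∩ (A \ A') ∩ (B \ B')).card : ℤ) + (P ∩ refl (A \ A') ∩ (B \ B')).card + (P ∩ (A \ A') ∩ refl (B \ B')).card
            - 2 * ((P ∩ refl (A \ A') ∩ refl (B \ B')).card : ℤ))
        + (2 * ((P ∩ (A' \ A) ∩ (B' \ B)).card : ℤ) + (P ∩ refl (A' \ A) ∩ (B' \ B)).card + (P ∩ (A' \ A) ∩ refl (B' \ B)).card
            - 2 * ((P ∩ refl (A' \ A) ∩ refl (B' \ B)).card : ℤ)) := by
  unfold triWOne
  simp only [image_complEquiv, card_inter_inter_eq_sum_ite, mem_refl]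
  rw [← sub_eq_zero]
  simp only [← Finset.sum_add_distrib, ← Finset.sum_sub_distrib, Finset.mul_sum]
  refine Finset.sum_eq_zero fun e _ => ?_
  simp only [ite_mem_inter_eq, ite_mem_union_eq, ite_mem_sdiff_eq]
  ring

/-- **The uncrossing identity for `triW` at `a = 2`.**  For an index cube `univ = {a,b}` and ANY families `F, G` together with families
`F', G'` agreeing with them at `∅, univ` and carrying the uncrossed middles `F'{a} = F{a} ∩ F{b}`, `F'{b} = F{a} ∪ F{b}`, `G'{a} = G{a} ∪ G{b}`,
`G'{b} = G{a} ∩ G{b}`:  `triW P F G = triW P F' G' + X(F{a}∖F{b}, G{a}∖G{b}) + X(F{b}∖F{a}, G{b}∖G{a})`. [this work] -/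
theorem triW_uncross_eq {β : Type} [DecidableEq β] [Fintype β] {a b : β} (hab : a ≠ b) (hu : (univ : Finset β) = {a, b})
    (P : Finset (Finset γ)) (F G F' G' : Finset β → Finset (Finset γ))
    (hF0 : F' ∅ = F ∅) (hF1 : F' univ = F univ) (hFa : F' {a} = F {a} ∩ F {b}) (hFb : F' {b} = F {a} ∪ F {b})
    (hG0 : G' ∅ = G ∅) (hG1 : G' univ = G univ) (hGa : G' {a} = G {a} ∪ G {b}) (hGb : G' {b} = G {a} ∩ G {b}) :
    triW P F G = triW P F' G'
        + (2 * ((P ∩ (F {a} \ F {b}) ∩ (G {a} \ G {b})).card : ℤ) + (P ∩ refl (F {a} \ F {b}) ∩ (G {a} \ G {b})).card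
            + (P ∩ (F {a} \ F {b}) ∩ refl (G {a} \ G {b})).card - 2 * ((P ∩ refl (F {a} \ F {b}) ∩ refl (G {a} \ G {b})).card : ℤ))
        + (2 * ((P ∩ (F {b} \ F {a}) ∩ (G {b} \ G {a})).card : ℤ) + (P ∩ refl (F {b} \ F {a}) ∩ (G {b} \ G {a})).card
            + (P ∩ (F {b} \ F {a}) ∩ refl (G {b} \ G {a})).card - 2 * ((P ∩ refl (F {b} \ F {a}) ∩ refl (G {b} \ G {a})).card : ℤ)) := by
  rw [triW_eq_pairSum hab hu P F G, triW_eq_pairSum hab hu P F' G', hF0, hF1, hFa, hFb, hG0, hG1, hGa, hGb,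
    triWOne_uncross_eq P (F {a}) (F {b}) (G {a}) (G {b}), union_comm (G {a}) (G {b}), inter_comm (G {a}) (G {b})]
  ring

/-! ### Consequences via the anti-nested stratum theorem (AN♯3) -/

/-- **`TRI_W(2)` is at least its crossing terms.**  For every finite cube, every up-set `P` and monotone families `F, G` of up-sets over a two-atom
index cube: `triW P F G ≥ X(F{a}∖F{b}, G{a}∖G{b}) + X(F{b}∖F{a}, G{b}∖G{a})`, because the uncrossed families are anti-nested monotone families of
up-sets, for which `0 ≤ triW` (`triW_nonneg_of_antiNested_stratum`). [this work] -/
theorem triW_ge_cross {β : Type} [DecidableEq β] [Fintype β] {a b : β} (hab : a ≠ b) (hu : (univ : Finset β) = {a, b})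
    (P : Finset (Finset γ)) (F G : Finset β → Finset (Finset γ))
    (hP : IsUpperSet (P : Set (Finset γ))) (hF : ∀ x, IsUpperSet (F x : Set (Finset γ))) (hG : ∀ x, IsUpperSet (G x : Set (Finset γ)))
    (hFm : Monotone F) (hGm : Monotone G) :
    (2 * ((P ∩ (F {a} \ F {b}) ∩ (G {a} \ G {b})).card : ℤ) + (P ∩ refl (F {a} \ F {b}) ∩ (G {a} \ G {b})).card
            + (P ∩ (F {a} \ F {b}) ∩ refl (G {a} \ G {b})).card - 2 * ((P ∩ refl (F {a} \ F {b}) ∩ refl (G {a} \ G {b})).card : ℤ))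
        + (2 * ((P ∩ (F {b} \ F {a}) ∩ (G {b} \ G {a})).card : ℤ) + (P ∩ refl (F {b} \ F {a}) ∩ (G {b} \ G {a})).card
            + (P ∩ (F {b} \ F {a}) ∩ refl (G {b} \ G {a})).card - 2 * ((P ∩ refl (F {b} \ F {a}) ∩ refl (G {b} \ G {a})).card : ℤ))
      ≤ triW P F G := by
  classical
  -- membership bookkeeping on the two-atom index cube
  have hne_a : ({a} : Finset β) ≠ ∅ := singleton_ne_empty a
  have hne_b : ({b} : Finset β) ≠ ∅ := singleton_ne_empty b
  have hab' : ({a} : Finset β) ≠ {b} := by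
    intro h; exact hab (mem_singleton.1 (h ▸ mem_singleton_self a))
  have hau : ({a} : Finset β) ≠ univ := by
    intro h
    have : b ∈ ({a} : Finset β) := h ▸ mem_univ b
    exact hab (mem_singleton.1 this).symm
  have hbu : ({b} : Finset β) ≠ univ := by
    intro h
    have : a ∈ ({b} : Finset β) := h ▸ mem_univ a
    exact hab (mem_singleton.1 this)
  -- the uncrossed families
  let F' : Finset β → Finset (Finset γ) := fun x =>
    if x = {a} then F {a} ∩ F {b} else if x = {b} then F {a} ∪ F {b} else F x
  let G' : Finset β → Finset (Finset γ) := fun x =>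
    if x = {a} then G {a} ∪ G {b} else if x = {b} then G {a} ∩ G {b} else G x
  have hF0 : F' ∅ = F ∅ := by simp [F', Ne.symm hne_a, Ne.symm hne_b]
  have hF1 : F' univ = F univ := by simp [F', Ne.symm hau, Ne.symm hbu]
  have hFa : F' {a} = F {a} ∩ F {b} := by simp [F']
  have hFb : F' {b} = F {a} ∪ F {b} := by simp [F', hab'.symm]
  have hG0 : G' ∅ = G ∅ := by simp [G', Ne.symm hne_a, Ne.symm hne_b]
  have hG1 : G' univ = G univ := by simp [G', Ne.symm hau, Ne.symm hbu]
  have hGa : G' {a} = G {a} ∪ G {b} := by simp [G']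
  have hGb : G' {b} = G {a} ∩ G {b} := by simp [G', hab'.symm]
  -- every index is `∅`, `{a}`, `{b}` or `univ`
  have four : ∀ x : Finset β, x = ∅ ∨ x = {a} ∨ x = {b} ∨ x = univ := by
    intro x
    by_cases ha : a ∈ x <;> by_cases hb : b ∈ x
    · right; right; right
      refine eq_univ_of_forall fun y => ?_
      have hy : y ∈ (univ : Finset β) := mem_univ y
      rw [hu, mem_insert, mem_singleton] at hy
      rcases hy with rfl | rfl
      · exact ha
      · exact hb
    · right; left
      ext y; rw [mem_singleton]; constructor
      · intro hy
        have hy' : y ∈ (univ : Finset β) := mem_univ y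
        rw [hu, mem_insert, mem_singleton] at hy'
        rcases hy' with rfl | rfl
        · rfl
        · exact absurd hy hb
      · rintro rfl; exact ha
    · right; right; left
      ext y; rw [mem_singleton]; constructor
      · intro hy
        have hy' : y ∈ (univ : Finset β) := mem_univ y
        rw [hu, mem_insert, mem_singleton] at hy'
        rcases hy' with rfl | rfl
        · exact absurd hy ha
        · rfl
      · rintro rfl; exact hb
    · left
      refine eq_empty_of_forall_notMem fun y hy => ?_
      have hy' : y ∈ (univ : Finset β) := mem_univ y
      rw [hu, mem_insert, mem_singleton] at hy'
      rcases hy' with rfl | rfl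
      · exact ha hy
      · exact hb hy
  -- values of the uncrossed families, index by index
  have valF : ∀ x, F' x = F ∅ ∧ x = ∅ ∨ F' x = F {a} ∩ F {b} ∧ x = {a} ∨ F' x = F {a} ∪ F {b} ∧ x = {b} ∨ F' x = F univ ∧ x = univ := by
    intro x; rcases four x with rfl | rfl | rfl | rfl
    · exact Or.inl ⟨hF0, rfl⟩
    · exact Or.inr (Or.inl ⟨hFa, rfl⟩)
    · exact Or.inr (Or.inr (Or.inl ⟨hFb, rfl⟩))
    · exact Or.inr (Or.inr (Or.inr ⟨hF1, rfl⟩))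
  have valG : ∀ x, G' x = G ∅ ∧ x = ∅ ∨ G' x = G {a} ∪ G {b} ∧ x = {a} ∨ G' x = G {a} ∩ G {b} ∧ x = {b} ∨ G' x = G univ ∧ x = univ := by
    intro x; rcases four x with rfl | rfl | rfl | rfl
    · exact Or.inl ⟨hG0, rfl⟩
    · exact Or.inr (Or.inl ⟨hGa, rfl⟩)
    · exact Or.inr (Or.inr (Or.inl ⟨hGb, rfl⟩))
    · exact Or.inr (Or.inr (Or.inr ⟨hG1, rfl⟩))
  -- up-sets
  have hF' : ∀ x, IsUpperSet (F' x : Set (Finset γ)) := by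
    intro x; rcases valF x with ⟨h, -⟩ | ⟨h, -⟩ | ⟨h, -⟩ | ⟨h, -⟩ <;> rw [h]
    · exact hF ∅
    · rw [coe_inter]; exact (hF {a}).inter (hF {b})
    · rw [coe_union]; exact (hF {a}).union (hF {b})
    · exact hF univ
  have hG' : ∀ x, IsUpperSet (G' x : Set (Finset γ)) := by
    intro x; rcases valG x with ⟨h, -⟩ | ⟨h, -⟩ | ⟨h, -⟩ | ⟨h, -⟩ <;> rw [h]
    · exact hG ∅
    · rw [coe_union]; exact (hG {a}).union (hG {b})
    · rw [coe_inter]; exact (hG {a}).inter (hG {b})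
    · exact hG univ
  -- the chains `F ∅ ⊆ F{a}∩F{b} ⊆ F{a}∪F{b} ⊆ F univ`, `G ∅ ⊆ G{a}∩G{b} ⊆ G{a}∪G{b} ⊆ G univ`
  have cF1 : F ∅ ⊆ F {a} ∩ F {b} := subset_inter (hFm (empty_subset _)) (hFm (empty_subset _))
  have cF2 : F {a} ∩ F {b} ⊆ F {a} ∪ F {b} := inter_subset_left.trans subset_union_left
  have cF3 : F {a} ∪ F {b} ⊆ F univ := union_subset (hFm (subset_univ _)) (hFm (subset_univ _))
  have cG1 : G ∅ ⊆ G {a} ∩ G {b} := subset_inter (hGm (empty_subset _)) (hGm (empty_subset _))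
  have cG2 : G {a} ∩ G {b} ⊆ G {a} ∪ G {b} := inter_subset_left.trans subset_union_left
  have cG3 : G {a} ∪ G {b} ⊆ G univ := union_subset (hGm (subset_univ _)) (hGm (subset_univ _))
  -- monotonicity of the uncrossed families (case analysis over the four indices)
  have hFm' : Monotone F' := by
    intro x y hxy
    rcases four x with rfl | rfl | rfl | rfl <;> rcases four y with rfl | rfl | rfl | rfl <;>
      simp only [hF0, hF1, hFa, hFb] <;>
      first
      | exact Subset.rfl
      | exact cF1 | exact cF1.trans cF2 | exact cF1.trans (cF2.trans cF3) | exact cF2.trans cF3 | exact cF3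
      | exact absurd (subset_empty.1 hxy) hne_a
      | exact absurd (subset_empty.1 hxy) hne_b
      | exact absurd (mem_singleton.1 (hxy (mem_singleton_self a))) hab
      | exact absurd (mem_singleton.1 (hxy (mem_singleton_self b))) hab.symm
      | exact absurd (subset_antisymm (subset_univ _) hxy) hau
      | exact absurd (subset_antisymm (subset_univ _) hxy) hbu
      | exact absurd (hxy (mem_univ a)) (notMem_empty a)
  have hGm' : Monotone G' := by
    intro x y hxy
    rcases four x with rfl | rfl | rfl | rfl <;> rcases four y with rfl | rfl | rfl | rfl <;>
      simp only [hG0, hG1, hGa, hGb] <;>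
      first
      | exact Subset.rfl
      | exact cG1.trans cG2 | exact cG1 | exact cG1.trans (cG2.trans cG3) | exact cG3 | exact cG2.trans cG3
      | exact absurd (subset_empty.1 hxy) hne_a
      | exact absurd (subset_empty.1 hxy) hne_b
      | exact absurd (mem_singleton.1 (hxy (mem_singleton_self a))) hab
      | exact absurd (mem_singleton.1 (hxy (mem_singleton_self b))) hab.symm
      | exact absurd (subset_antisymm (subset_univ _) hxy) hau
      | exact absurd (subset_antisymm (subset_univ _) hxy) hbu
      | exact absurd (hxy (mem_univ a)) (notMem_empty a)
  -- the uncrossed configuration is anti-nested: `F'{a} ⊆ F'{b}` and `G'{b} ⊆ G'{a}`; apply AN♯3 with the roles of `a, b` swapped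
  have hu' : (univ : Finset β) = {b, a} := by rw [hu, pair_comm]
  have hpos : 0 ≤ triW P F' G' :=
    triW_nonneg_of_antiNested_stratum hab.symm hu' P F' G' hP hF' hG' hFm' hGm' (by rw [hFa, hFb]; exact cF2) (by rw [hGa, hGb]; exact cG2)
  have hid := triW_uncross_eq hab hu P F G F' G' hF0 hF1 hFa hFb hG0 hG1 hGa hGb
  linarith

/-- **No complement of a double crossing in `P` ⟹ `TRI_W(2) ≥ 0`.**  With the double-crossing cells `D_a = (F{a}∖F{b}) ∩ (G{a}∖G{b})`,
`D_b = (F{b}∖F{a}) ∩ (G{b}∖G{a})`: if `P ∩ refl D_a = ∅` and `P ∩ refl D_b = ∅` then `0 ≤ triW P F G` (monotone families of up-sets, `P` an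
up-set, two-atom index cube). [this work] -/
theorem triW_nonneg_of_refl_crossings_disjoint {β : Type} [DecidableEq β] [Fintype β] {a b : β} (hab : a ≠ b)
    (hu : (univ : Finset β) = {a, b}) (P : Finset (Finset γ)) (F G : Finset β → Finset (Finset γ))
    (hP : IsUpperSet (P : Set (Finset γ))) (hF : ∀ x, IsUpperSet (F x : Set (Finset γ))) (hG : ∀ x, IsUpperSet (G x : Set (Finset γ)))
    (hFm : Monotone F) (hGm : Monotone G)
    (hDa : P ∩ refl ((F {a} \ F {b}) ∩ (G {a} \ G {b})) = ∅) (hDb : P ∩ refl ((F {b} \ F {a}) ∩ (G {b} \ G {a})) = ∅) :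
    0 ≤ triW P F G := by
  have h := triW_ge_cross hab hu P F G hP hF hG hFm hGm
  have e1 : P ∩ refl (F {a} \ F {b}) ∩ refl (G {a} \ G {b}) = ∅ := by rw [inter_assoc, ← refl_inter]; exact hDa
  have e2 : P ∩ refl (F {b} \ F {a}) ∩ refl (G {b} \ G {a}) = ∅ := by rw [inter_assoc, ← refl_inter]; exact hDb
  rw [e1, e2, card_empty] at h
  push_cast at h
  linarith [Int.natCast_nonneg (P ∩ (F {a} \ F {b}) ∩ (G {a} \ G {b})).card,
    Int.natCast_nonneg (P ∩ refl (F {a} \ F {b}) ∩ (G {a} \ G {b})).card,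
    Int.natCast_nonneg (P ∩ (F {a} \ F {b}) ∩ refl (G {a} \ G {b})).card,
    Int.natCast_nonneg (P ∩ (F {b} \ F {a}) ∩ (G {b} \ G {a})).card,
    Int.natCast_nonneg (P ∩ refl (F {b} \ F {a}) ∩ (G {b} \ G {a})).card,
    Int.natCast_nonneg (P ∩ (F {b} \ F {a}) ∩ refl (G {b} \ G {a})).card]

/-- **THE CROSSING-FREE STRATUM of `TRI_W(2)` (unconditional).**  For every finite cube, every up-set `P` and monotone families `F, G` of up-sets
over a two-atom index cube `univ = {a,b}`: if `F{a} ∩ G{a} ⊆ F{b} ∪ G{b}` and `F{b} ∩ G{b} ⊆ F{a} ∪ G{a}` (no point is strictly on the `a`-side,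
resp. the `b`-side, of both families — the double-crossing cells are empty), then `0 ≤ triW P F G`.  Contains both anti-nested strata
(`F{b} ⊆ F{a}, G{a} ⊆ G{b}` and its mirror) and is symmetric under `a ↔ b` and `F ↔ G`. [this work] -/
theorem triW_nonneg_of_crossing_free {β : Type} [DecidableEq β] [Fintype β] {a b : β} (hab : a ≠ b)
    (hu : (univ : Finset β) = {a, b}) (P : Finset (Finset γ)) (F G : Finset β → Finset (Finset γ))
    (hP : IsUpperSet (P : Set (Finset γ))) (hF : ∀ x, IsUpperSet (F x : Set (Finset γ))) (hG : ∀ x, IsUpperSet (G x : Set (Finset γ)))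
    (hFm : Monotone F) (hGm : Monotone G)
    (ha : F {a} ∩ G {a} ⊆ F {b} ∪ G {b}) (hb : F {b} ∩ G {b} ⊆ F {a} ∪ G {a}) :
    0 ≤ triW P F G := by
  have dA : (F {a} \ F {b}) ∩ (G {a} \ G {b}) = ∅ := by
    refine eq_empty_of_forall_notMem fun e he => ?_
    rw [mem_inter, mem_sdiff, mem_sdiff] at he
    rcases mem_union.1 (ha (mem_inter.2 ⟨he.1.1, he.2.1⟩)) with h | h
    · exact he.1.2 h
    · exact he.2.2 h
  have dB : (F {b} \ F {a}) ∩ (G {b} \ G {a}) = ∅ := by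
    refine eq_empty_of_forall_notMem fun e he => ?_
    rw [mem_inter, mem_sdiff, mem_sdiff] at he
    rcases mem_union.1 (hb (mem_inter.2 ⟨he.1.1, he.2.1⟩)) with h | h
    · exact he.1.2 h
    · exact he.2.2 h
  have r0 : refl (∅ : Finset (Finset γ)) = ∅ := by
    ext s; simp [mem_refl]
  refine triW_nonneg_of_refl_crossings_disjoint hab hu P F G hP hF hG hFm hGm ?_ ?_
  · rw [dA, r0, inter_empty]
  · rw [dB, r0, inter_empty]

end FiveUpSet

end Summit.CriticalPhenomena.PercolationContinuityZ3.Theorems
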